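import Mathlib
import HarnessLib
import Summits.HubbardSuperconductivity.HubbardSuperconductivity.Theorems.KLProgrammeKLRegimeEnginePairTransferMemberPHSignedRowSharpTC
import Summits.HubbardSuperconductivity.HubbardSuperconductivity.Theorems.KLProgrammeLatticeSoftBubbleModelSharpTCCellsSq
import Summits.HubbardSuperconductivity.HubbardSuperconductivity.Theorems.KLProgrammeLatticeCellsRayData

/-!
# Route `KLProgramme` — ENGINE stmt-HubbardSuperconductivity-20437 `KLRegimeEngineV17F2`, row (c) value lane / class-#5 STEP (X).3 pinned pair: THE SIGNED MEMBER PH ROW WITH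
# ANGULAR-CELL KERNEL DATA — `klmsRowBoundTCC` and `klms_pinned_bubble_norm_le_genTCC` (brick (L3)-6 of cure (A″) route 3′ of located «(c)-OUT-COOPER-ANTIPODE»; cell
# gate-hubbard-kl, seat hubbard-kl-k3c2-p2 g26, technique «thermal-bar induction n ≤ nScales β + 1 with EngineBoundsAtV4S sums»)

WHY.  `klmsRowBoundTC`/`klms_pinned_bubble_norm_le_genTC` (…MemberPHSignedRowSharpTC, the member row of record) book the pin `Y` through its sup `A₀` and ONE GLOBAL torus-Lipschitz
constant `L_A`, which enters the zero-sound piece `(64/π)·8·(π√2/(d−4A)·(2L_A + 40A₀)/(d−4A) + …)·Λₙ₊₁` — vacuous near the Cooper antipode at deep scales (COOPER-ANTIPODE.md §2).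
Here the pin carries ANGULAR-CELL data (…LatticeCellsRayData): a global constant `K_g` (any size; it enters ONLY the lattice piece `LAT/L` and the scale-free defect), arcs
`[α_c, β_c]` covering `(−π, π)` with serving sets `S_c` around the frame's Fermi curve and cell constants `Lc_c`; the zero-sound piece reads the ARC-WEIGHTED SUM
`I₁ = Σ_c Lc_c·(β_c − α_c)` in place of `2π·2L_A`, plus the scale-free defect `(128/π)·(8/Λₙ₊₁)·(π√2/(d−4A))·I_δ`, `I_δ = Σ_c (2Lc_c + 4K_g)(π/L)(β_c − α_c)` (lattice slot).
* §1 `klmsRowBoundTCC d A G A₀ K_g I₁ I_δ β n j δ L` (closed expression); §2 `klms_setIntegral_affine_le`;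
* §3 **`klms_pinned_bubble_norm_le_genTCC`** (general partner scale `klPhiC Λ_m Λ′`, shift `q₀`): `‖Σ_p Y(k̃)·Φ_Ẇ·Φ_d‖ ≤ βL²·klmsRowBoundTCC …`;
* §4 `klmsRowBoundTCC_reading` (exact reading in the STEP's normalisation, as `klmsRowBoundTC_reading`).
Pure composition of landed rows + bookkeeping; nothing about the model's effective action is asserted; nothing asserts (X).3, (c), K3 or superconductivity.
References: BGM 2006 §2.4–2.5 [cite: BenfattoGiulianiMastropietro2006]; FST 1998 App. B [cite: FeldmanSalmhoferTrubowitz1998].  0 kit · 0 lit.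
-/

noncomputable section

namespace Summit.HubbardSuperconductivity.HubbardSuperconductivity.Theorems.KLRegimeSplit

set_option linter.dupNamespace false -- summit = problem name (single-conjunct summit), D-0017

open Real Set Finset MeasureTheory Complex Literature.MathematicalPhysics.QuantumLattice
open Literature.Probability.LatticeModels hiding torusSupNorm
open Literature.MathematicalPhysics.QuantumLattice.BandSectorCounting
open Summit.HubbardSuperconductivity.HubbardSuperconductivity.Theorems.KLProgrammeLegKernels
open Summit.HubbardSuperconductivity.HubbardSuperconductivity.Theorems.KLRegimeWick
open Summit.HubbardSuperconductivity.HubbardSuperconductivity.Theorems.TwoPointAssembly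
open Summit.HubbardSuperconductivity.HubbardSuperconductivity.Theorems.DispersionFlow
open Summit.HubbardSuperconductivity.HubbardSuperconductivity.Theorems.PerturbedFermiCurve
open Summit.HubbardSuperconductivity.HubbardSuperconductivity.Theorems.EngineV8

/-! ## §1 The row bound with angular-cell kernel data, as a closed expression -/

/-- **The signed member row's right side with ANGULAR-CELL kernel data** at index `n+1`: the zero-sound piece reads the arc-weighted Lipschitz sum `I₁` (coefficient
`((2π)²)⁻¹·(64/π)(8/Λ)(π√2/(d−4A)/(d−4A))·Λ`) and the defect sum `I_δ` (coefficient `((2π)²)⁻¹·(128/π)(8/Λ)(π√2/(d−4A))`, scale-free); the `A₀`-parts of the zero-sound piece, the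
thermal and transfer pieces are those of `klmsRowBoundTC` (data `2A₀`); the lattice piece carries the GLOBAL constant `2K_g`. -/
def klmsRowBoundTCC (d A G A₀ Kg I₁ Iδ β : ℝ) (n j : ℕ) (δ : ℝ) (L : ℕ) : ℝ :=
  ((2 * π) ^ 2)⁻¹ *
      (64 / Real.pi * (8 / klScale klE0 (n + 1)) * (Real.pi * Real.sqrt 2 / (d - 4 * A) / (d - 4 * A)) * klScale klE0 (n + 1) * I₁ +
        128 / Real.pi * (8 / klScale klE0 (n + 1)) * (Real.pi * Real.sqrt 2 / (d - 4 * A)) * Iδ +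
        2 * Real.pi *
          (64 / Real.pi * (8 / klScale klE0 (n + 1)) *
              (Real.pi * Real.sqrt 2 / (d - 4 * A) * (2 * A₀ * (2 / (1 / 10))) / (d - 4 * A) +
                2 * A₀ * (1 / (d - 4 * A) ^ 2 + Real.pi * Real.sqrt 2 * (2 + 4 * A) / (d - 4 * A) ^ 3)) * klScale klE0 (n + 1) +
            393216 / Real.pi *
                ((8 / klScale klE0 (n + 1) * (8 / klScale klE0 j ^ 2) +
                      1 * ((2 * (448 / 3 * Real.exp 2) + 8) / klScale klE0 (n + 1) / klScale klE0 (n + 1) ^ 2)) *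
                    klScale klE0 (n + 1) ^ 2 +
                  8 * (8 / klScale klE0 (n + 1))) *
              (2 * A₀ * (Real.pi * Real.sqrt 2 / (d - 4 * A))) * ((Real.pi / β) / klScale klE0 (n + 1)) +
            (64 / Real.pi * (8 / klScale klE0 (n + 1)) * (2 * A₀ * (Real.pi * Real.sqrt 2 / (d - 4 * A))) *
                ((3 * (8 * (16 : ℝ) ^ (j - (n + 1))) + 512 * 1) / klScale klE0 (n + 1) ^ 2 * klScale klE0 (n + 1)) * (|(0 : ℝ)| + δ) +
              48 / Real.pi * (8 / klScale klE0 (n + 1)) * (2 * A₀ * (Real.pi * Real.sqrt 2 / (d - 4 * A))) *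
                ((3 * (8 * (16 : ℝ) ^ (j - (n + 1))) + 512 * 1) / klScale klE0 (n + 1) ^ 2 * klScale klE0 (n + 1)) * (|(0 : ℝ)| + δ) *
                  ((Real.pi / β) / klScale klE0 (n + 1))))) +
    32 * klScale klE0 (n + 1) *
        (2 * Kg * (2 * (8 / klScale klE0 (n + 1)) / klScale klE0 (n + 1)) * (16 * 1 / klScale klE0 (n + 1)) +
          2 * A₀ * ((9 * ((2 * (448 / 3 * Real.exp 2) + 8) / klScale klE0 (n + 1)) + 4 * (8 / klScale klE0 (n + 1))) / klScale klE0 (n + 1) ^ 2 * G) *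
            (16 * 1 / klScale klE0 (n + 1)) +
          2 * A₀ * (2 * (8 / klScale klE0 (n + 1)) / klScale klE0 (n + 1)) *
            ((3 * (8 * (16 : ℝ) ^ (j - (n + 1))) + 512 * 1) / klScale klE0 (n + 1) ^ 2 * G)) / L

/-! ## §2 Integrating an affine expression of two angle profiles -/

/-- `∫_{(−π,π)} (c₁f + c₂g + c₀) ≤ c₁I₁ + c₂I₂ + 2π·c₀` for integrable `f, g` with `∫f ≤ I₁`, `∫g ≤ I₂`, `c₁, c₂ ≥ 0`. -/
theorem klms_setIntegral_affine_le {f g : ℝ → ℝ} (hf : IntegrableOn f (Ioo (-π) π)) (hg : IntegrableOn g (Ioo (-π) π))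
    {c₁ c₂ c₀ I₁ I₂ : ℝ} (hc₁ : 0 ≤ c₁) (hc₂ : 0 ≤ c₂) (hI₁ : ∫ θ in Ioo (-π) π, f θ ≤ I₁) (hI₂ : ∫ θ in Ioo (-π) π, g θ ≤ I₂) :
    ∫ θ in Ioo (-π) π, (c₁ * f θ + c₂ * g θ + c₀) ≤ c₁ * I₁ + c₂ * I₂ + 2 * π * c₀ := by
  have hvol : volume (Ioo (-π) π) < ⊤ := by rw [Real.volume_Ioo]; exact ENNReal.ofReal_lt_top
  have hc : IntegrableOn (fun _ : ℝ => c₀) (Ioo (-π) π) := integrableOn_const (hs := hvol.ne)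
  have h1 : IntegrableOn (fun θ => c₁ * f θ) (Ioo (-π) π) := hf.const_mul c₁
  have h2 : IntegrableOn (fun θ => c₂ * g θ) (Ioo (-π) π) := hg.const_mul c₂
  have e1 : ∫ θ in Ioo (-π) π, (c₁ * f θ + c₂ * g θ + c₀) = (∫ θ in Ioo (-π) π, (c₁ * f θ + c₂ * g θ)) + ∫ _ in Ioo (-π) π, c₀ :=
    integral_add (h1.add h2) hc
  have e2 : ∫ θ in Ioo (-π) π, (c₁ * f θ + c₂ * g θ) = (∫ θ in Ioo (-π) π, c₁ * f θ) + ∫ θ in Ioo (-π) π, c₂ * g θ := integral_add h1 h2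
  have hconst : ∫ _ in Ioo (-π) π, c₀ = 2 * π * c₀ := by
    rw [setIntegral_const, smul_eq_mul, Measure.real, Real.volume_Ioo, ENNReal.toReal_ofReal (by linarith [Real.pi_pos])]
    ring
  rw [e1, e2, integral_const_mul, integral_const_mul, hconst]
  nlinarith [mul_le_mul_of_nonneg_left hI₁ hc₁, mul_le_mul_of_nonneg_left hI₂ hc₂]

/-! ## §3 The pinned bubble with angular-cell kernel data (general partner scale and shift) -/

section Generic

variable {L M : ℕ} [NeZero L] (β μ : ℝ) (K : TrigPolyC4v)
variable {a' b' : ℝ} (B : BandBounds a' b') {R : RenConsts} {U : ℝ} {N : ℕ} {A : ℝ}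

/-- **PINNED BUBBLE WITH ANGULAR-CELL KERNEL DATA, general partner scale**: `d = klPhiC Λ_m Λ′` with `n+1 ≤ m`, `Λₙ₊₁ ≤ Λ′ ≤ Λₙ`, shift `|q₀| ≤ Λₙ₊₁/8`; the
momentum-only weight `Y` has sup `A₀`, GLOBAL torus-Lipschitz constant `K_g`, and is `Lc_c`-Lipschitz on the serving set `S_c` of each angular cell (arcs `[α_c, β_c]` covering
`(−π, π)`; `S_c` contains every lattice momentum within torus sup-distance `r ≥ 4Λₙ₊₁/(Dt_min − 4A) + π/L` of the frame's Fermi point `u_K(θ)·dir θ`, `θ ∈ [α_c, β_c]`,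
`u_K = perturbedFermiRadius δ_K μ` — i.e. of `klFermiPoint μ K θ`):
`‖Σ_p Y(k̃)·Φ_Ẇ(ω_p, e_K k̃)·Φ_d(ω_p + q₀, e_K(k̃ + q̃))‖ ≤ βL²·klmsRowBoundTCC d A G A₀ K_g I₁ I_δ β n m (|q₀| + G|p_q̃|_𝕋) L` with the arc-weighted sums
`I₁ = Σ_c Lc_c(β_c − α_c)`, `I_δ = Σ_c (2Lc_c + 4K_g)(π/L)(β_c − α_c)`. -/
theorem klms_pinned_bubble_norm_le_genTCC (hR : ∀ j, 0 ≤ R.Gfr j) (hK : FrameOK R U N μ K)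
    (hAb : ∀ p : Momentum, ∀ j ≤ 2, ‖iteratedFDeriv ℝ j (frameShift K) p‖ ≤ A) (hA : 4 * A < B.Dtmin) (hA20 : 4 * A ≤ 1 / 20) (hμ : μ ≤ -0.15)
    (n : ℕ) {t : ℝ} (ht : t ∈ Icc (0 : ℝ) 1) {m : ℕ} (hm : n + 1 ≤ m) {Λ' : ℝ} (hlo'' : klScale klE0 (n + 1) ≤ Λ') (hhi'' : Λ' ≤ klScale klE0 n)
    (hlo : a' < μ - 4 * klScale klE0 (n + 1) - 4 * A) (hhi : μ + 4 * klScale klE0 (n + 1) + 4 * A < b')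
    (hβ : klBetaMin ≤ β) (hn : n + 1 ≤ nScales β + 1) (hM : β * (4 * klScale klE0 (n + 1)) / (2 * Real.pi) + 1 ≤ M)
    (q : TorusSite 2 L) (hq : (4 + 8 / 3 * R.Gfr 1 * U ^ 2) * klTorusNorm L q ≤ klScale klE0 (n + 1) / 8) {q₀ : ℝ} (hq₀ : |q₀| ≤ klScale klE0 (n + 1) / 8)
    {Y : TorusSite 2 L → ℂ} {A₀ Kg : ℝ} (hA0 : 0 ≤ A₀) (hKg : 0 ≤ Kg) (hY0 : ∀ k, ‖Y k‖ ≤ A₀)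
    (hY1 : ∀ k k', ‖Y k - Y k'‖ ≤ Kg * klTorusNorm L (k - k'))
    {ι : Type*} [Fintype ι] {S : ι → Finset (TorusSite 2 L)} {αc βc Lc : ι → ℝ} (hαβ : ∀ c, αc c ≤ βc c) (hLc : ∀ c, 0 ≤ Lc c)
    {r : ℝ} (hr : 4 * klScale klE0 (n + 1) / (B.Dtmin - 4 * A) + Real.pi / L ≤ r)
    (hserve : ∀ c, ∀ θ ∈ Icc (αc c) (βc c), ∀ k : TorusSite 2 L,
      torusSupNorm (klpeP L k -
        (perturbedFermiRadius (fun k : Fin 2 → ℝ => frameShift K (WithLp.toLp 2 k)) μ θ * Real.cos θ,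
          perturbedFermiRadius (fun k : Fin 2 → ℝ => frameShift K (WithLp.toLp 2 k)) μ θ * Real.sin θ)) ≤ r → k ∈ S c)
    (hcell : ∀ c, ∀ k ∈ S c, ∀ k' ∈ S c, ‖Y k - Y k'‖ ≤ Lc c * klTorusNorm L (k - k'))
    (hcover : ∀ θ ∈ Ioo (-π) π, ∃ c, θ ∈ Icc (αc c) (βc c)) :
    ‖∑ p : FreqMomentum L M, Y p.2 *
        (klfb_prop (klWdC (klScale klE0 n + t * (klScale klE0 (n + 1) - klScale klE0 n))) (matsubaraFreq β M p.1) (nambuXiCT L μ K p.2) *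
          klfb_prop (klPhiC (klScale klE0 m) Λ') (matsubaraFreq β M p.1 + q₀) (nambuXiCT L μ K (p.2 + q)))‖ ≤
      β * (L : ℝ) ^ 2 * klmsRowBoundTCC B.Dtmin A (4 + 8 / 3 * R.Gfr 1 * U ^ 2) A₀ Kg (∑ c, Lc c * (βc c - αc c))
        (∑ c, (2 * Lc c + 4 * Kg) * (Real.pi / L) * (βc c - αc c)) β n m (|q₀| + (4 + 8 / 3 * R.Gfr 1 * U ^ 2) * klTorusNorm L q) L := by
  set Λt : ℝ := klScale klE0 n + t * (klScale klE0 (n + 1) - klScale klE0 n) with hΛt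
  obtain ⟨hlo', hhi'⟩ := scaleAt_mem n ht
  have hΛ1 := klth_klScale_pos (n + 1)
  have hβ0 : 0 < β := lt_of_lt_of_le (by norm_num [klBetaMin]) hβ
  have hd : 0 < B.Dtmin - 4 * A := by linarith
  set a : ℝ × ℝ → ℂ := klpeExt Y A₀ Kg with ha
  obtain ⟨hbd, hlip, hin, hout⟩ := klfw_sliceWeight_hypotheses hlo' hhi'
  obtain ⟨hdbd, hdlip, -, -⟩ := klfw_partner_hypotheses hlo'' hhi'' hm
  have hFbd : ∀ s, ‖klWdC Λt s * klPhiC (klScale klE0 m) Λ' s‖ ≤ 8 / klScale klE0 (n + 1) := fun s =>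
    (klwt_mul_norm_le hbd hdbd s).trans (by rw [mul_one])
  have hFlip := klwt_mul_lipschitz hbd hdbd hlip hdlip
  have hLf' : 8 / klScale klE0 m ^ 2 ≤ 8 * (16 : ℝ) ^ (m - (n + 1)) / klScale klE0 (n + 1) ^ 2 := (klfw_partner_lipschitz_scale hm).le
  have hLF : 8 / klScale klE0 (n + 1) * (8 / klScale klE0 m ^ 2) + 1 * ((2 * (448 / 3 * Real.exp 2) + 8) / klScale klE0 (n + 1) / klScale klE0 (n + 1) ^ 2) ≤
      (8 / klScale klE0 (n + 1) * (8 / klScale klE0 m ^ 2) + 1 * ((2 * (448 / 3 * Real.exp 2) + 8) / klScale klE0 (n + 1) / klScale klE0 (n + 1) ^ 2)) *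
          klScale klE0 (n + 1) ^ 2 / klScale klE0 (n + 1) ^ 2 :=
    le_of_eq (by rw [mul_div_cancel_right₀ _ (pow_ne_zero 2 hΛ1.ne')])
  -- frame data for the cell ⇒ ray lemma
  have hsm := frameShift_toLp_small hAb le_rfl
  have haq := klcr_ext_ray_quasi_of_cells B (contDiff_frameShift_toLp K) (fun k _ => hsm.1 k) (fun k _ => hsm.2.1 k) hA hlo hhi hKg hY0 hY1
    hLc hr hserve hcell hcover
  have h := klfl_lattice_soft_bubble_norm_le_modelTC_cellsSq B hR hK hAb hA hA20 hμ (klpe_continuous_ext Y A₀ hKg) (klpe_ext_periodic₁ Y A₀ Kg)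
    (klpe_ext_periodic₂ Y A₀ Kg) (klpe_norm_ext_le Y hA0 Kg) (klpe_ext_lipschitz Y A₀ hKg) (n := n + 1) (Nat.le_add_left 1 n) q hq
    (klcrA1_nonneg hLc) (klcrδA_nonneg hLc hKg L) (klcrA1_integrableOn αc βc Lc) (klcrδA_integrableOn αc βc Lc Kg L) haq
    hlip hbd le_rfl hin hout hdlip hdbd hLf' (by positivity) hFlip hFbd hLF hlo hhi hq₀ hβ hn hM
  have hsum : (∑ p : FreqMomentum L M, Y p.2 *
        (klfb_prop (klWdC Λt) (matsubaraFreq β M p.1) (nambuXiCT L μ K p.2) *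
          klfb_prop (klPhiC (klScale klE0 m) Λ') (matsubaraFreq β M p.1 + q₀) (nambuXiCT L μ K (p.2 + q)))) =
      (((β * (L : ℝ) ^ 2 : ℝ)) : ℂ) * (β⁻¹ • ∑ i : MatsubaraIdx M, ((L ^ 2 : ℕ) : ℝ)⁻¹ • ∑ k : TorusSite 2 L,
        a (latticeMomentum L k 0, latticeMomentum L k 1) * klfb_prop (klWdC Λt) (matsubaraFreq β M i) (nambuXiCT L μ K k) *
          klfb_prop (klPhiC (klScale klE0 m) Λ') (matsubaraFreq β M i + q₀) (nambuXiCT L μ K (k + q))) := by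
    rw [← klrf_sum_freqMomentum_eq_smul hβ0.ne']
    refine Finset.sum_congr rfl fun p _ => ?_
    rw [ha, klpe_ext_apply_latticeMomentum hY0 hY1, mul_assoc]
  rw [hsum, norm_mul, Complex.norm_real, Real.norm_of_nonneg (by positivity)]
  refine mul_le_mul_of_nonneg_left (h.trans ?_) (by positivity)
  -- integrate the affine angle profile
  set d := B.Dtmin with hd_def
  set G := 4 + 8 / 3 * R.Gfr 1 * U ^ 2 with hG
  set MF : ℝ := 8 / klScale klE0 (n + 1) with hMF
  set c₁ : ℝ := 64 / Real.pi * MF * (Real.pi * Real.sqrt 2 / (d - 4 * A) / (d - 4 * A)) * klScale klE0 (n + 1) with hc₁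
  set c₂ : ℝ := 128 / Real.pi * MF * (Real.pi * Real.sqrt 2 / (d - 4 * A)) with hc₂
  set c₀ : ℝ :=
    64 / Real.pi * MF *
        (Real.pi * Real.sqrt 2 / (d - 4 * A) * (2 * A₀ * (2 / (1 / 10))) / (d - 4 * A) +
          2 * A₀ * (1 / (d - 4 * A) ^ 2 + Real.pi * Real.sqrt 2 * (2 + 4 * A) / (d - 4 * A) ^ 3)) * klScale klE0 (n + 1) +
      393216 / Real.pi *
          ((8 / klScale klE0 (n + 1) * (8 / klScale klE0 m ^ 2) +
                1 * ((2 * (448 / 3 * Real.exp 2) + 8) / klScale klE0 (n + 1) / klScale klE0 (n + 1) ^ 2)) *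
              klScale klE0 (n + 1) ^ 2 +
            8 * MF) *
        (2 * A₀ * (Real.pi * Real.sqrt 2 / (d - 4 * A))) * ((Real.pi / β) / klScale klE0 (n + 1)) +
      (64 / Real.pi * MF * (2 * A₀ * (Real.pi * Real.sqrt 2 / (d - 4 * A))) *
          ((3 * (8 * (16 : ℝ) ^ (m - (n + 1))) + 512 * 1) / klScale klE0 (n + 1) ^ 2 * klScale klE0 (n + 1)) * (|q₀| + G * klTorusNorm L q) +
        48 / Real.pi * MF * (2 * A₀ * (Real.pi * Real.sqrt 2 / (d - 4 * A))) *
          ((3 * (8 * (16 : ℝ) ^ (m - (n + 1))) + 512 * 1) / klScale klE0 (n + 1) ^ 2 * klScale klE0 (n + 1)) * (|q₀| + G * klTorusNorm L q) *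
            ((Real.pi / β) / klScale klE0 (n + 1))) with hc₀
  have hc₁0 : 0 ≤ c₁ := by positivity
  have hc₂0 : 0 ≤ c₂ := by positivity
  have hI := klms_setIntegral_affine_le (klcrA1_integrableOn αc βc Lc) (klcrδA_integrableOn αc βc Lc Kg L) hc₁0 hc₂0
    (integral_klcrA1_le hαβ hLc) (integral_klcrδA_le hαβ hLc hKg L) (c₀ := c₀)
  have heq : (∫ θ in Ioo (-π) π,
      (64 / Real.pi * MF *
            (Real.pi * Real.sqrt 2 / (d - 4 * A) * (klcrA1 αc βc Lc θ + 2 * A₀ * (2 / (1 / 10))) / (d - 4 * A) +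
              2 * A₀ * (1 / (d - 4 * A) ^ 2 + Real.pi * Real.sqrt 2 * (2 + 4 * A) / (d - 4 * A) ^ 3)) * klScale klE0 (n + 1) +
          128 / Real.pi * MF * (Real.pi * Real.sqrt 2 / (d - 4 * A) * klcrδA αc βc Lc Kg L θ) +
          393216 / Real.pi *
              ((8 / klScale klE0 (n + 1) * (8 / klScale klE0 m ^ 2) +
                    1 * ((2 * (448 / 3 * Real.exp 2) + 8) / klScale klE0 (n + 1) / klScale klE0 (n + 1) ^ 2)) *
                  klScale klE0 (n + 1) ^ 2 +
                8 * MF) *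
            (2 * A₀ * (Real.pi * Real.sqrt 2 / (d - 4 * A))) * ((Real.pi / β) / klScale klE0 (n + 1)) +
          (64 / Real.pi * MF * (2 * A₀ * (Real.pi * Real.sqrt 2 / (d - 4 * A))) *
              ((3 * (8 * (16 : ℝ) ^ (m - (n + 1))) + 512 * 1) / klScale klE0 (n + 1) ^ 2 * klScale klE0 (n + 1)) * (|q₀| + G * klTorusNorm L q) +
            48 / Real.pi * MF * (2 * A₀ * (Real.pi * Real.sqrt 2 / (d - 4 * A))) *
              ((3 * (8 * (16 : ℝ) ^ (m - (n + 1))) + 512 * 1) / klScale klE0 (n + 1) ^ 2 * klScale klE0 (n + 1)) * (|q₀| + G * klTorusNorm L q) *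
                ((Real.pi / β) / klScale klE0 (n + 1))))) =
      ∫ θ in Ioo (-π) π, (c₁ * klcrA1 αc βc Lc θ + c₂ * klcrδA αc βc Lc Kg L θ + c₀) := by
    congr 1
    funext θ
    simp only [hc₁, hc₂, hc₀]
    ring
  rw [heq]
  refine (mul_le_mul_of_nonneg_left hI (by positivity) |> fun h' => add_le_add h' le_rfl) |>.trans ?_
  unfold klmsRowBoundTCC
  simp only [hc₁, hc₂, hc₀, hMF, hG, hd_def]
  refine le_of_eq ?_
  ring

end Generic

/-! ## §4 The exact reading of the row in the STEP's normalisation -/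

/-- **EXACT READING of the member row with angular-cell data in the STEP's normalisation** (`Λₙ − Λₙ₊₁ = 3Λₙ₊₁`):
`(Λₙ − Λₙ₊₁)·klmsRowBoundTCC = (3/(2π))·((64/π)·8·(π√2/(d−4A)/(d−4A))·I₁/(2π)·Λₙ₊₁ + (128/π)·8·(π√2/(d−4A))·I_δ/(2π) + ZS₀(A₀)·Λₙ₊₁ + TH₀·((π/β)/Λₙ₊₁) + TR₀·((|0|+δ)/Λₙ₊₁)) + LAT₀(K_g)/L`. -/
theorem klmsRowBoundTCC_reading (d A G A₀ Kg I₁ Iδ β : ℝ) (n j : ℕ) (δ : ℝ) (L : ℕ) [NeZero L] :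
    (klScale klE0 n - klScale klE0 (n + 1)) * klmsRowBoundTCC d A G A₀ Kg I₁ Iδ β n j δ L =
      3 / (2 * π) *
          ((64 / Real.pi * 8 * (Real.pi * Real.sqrt 2 / (d - 4 * A) / (d - 4 * A)) * (I₁ / (2 * π))) * klScale klE0 (n + 1) +
            (128 / Real.pi * 8 * (Real.pi * Real.sqrt 2 / (d - 4 * A)) * (Iδ / (2 * π))) +
            (64 / Real.pi * 8 *
                (Real.pi * Real.sqrt 2 / (d - 4 * A) * (2 * A₀ * (2 / (1 / 10))) / (d - 4 * A) +
                  2 * A₀ * (1 / (d - 4 * A) ^ 2 + Real.pi * Real.sqrt 2 * (2 + 4 * A) / (d - 4 * A) ^ 3))) *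
              klScale klE0 (n + 1) +
            (393216 / Real.pi * (64 * (klScale klE0 (n + 1) / klScale klE0 j) ^ 2 + (2 * (448 / 3 * Real.exp 2) + 8) + 64) *
                (2 * A₀ * (Real.pi * Real.sqrt 2 / (d - 4 * A)))) *
              ((Real.pi / β) / klScale klE0 (n + 1)) +
            ((64 / Real.pi * 8 * (2 * A₀ * (Real.pi * Real.sqrt 2 / (d - 4 * A))) * (3 * (8 * (16 : ℝ) ^ (j - (n + 1))) + 512 * 1) +
               48 / Real.pi * 8 * (2 * A₀ * (Real.pi * Real.sqrt 2 / (d - 4 * A))) * (3 * (8 * (16 : ℝ) ^ (j - (n + 1))) + 512 * 1) * ((Real.pi / β) / klScale klE0 (n + 1)))) *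
              ((|(0 : ℝ)| + δ) / klScale klE0 (n + 1))) +
        96 * (512 * Kg / klScale klE0 (n + 1) +
            32 * A₀ * G * ((9 * (2 * (448 / 3 * Real.exp 2) + 8) + 4 * 8) + (3 * (8 * (16 : ℝ) ^ (j - (n + 1))) + 512 * 1)) /
              klScale klE0 (n + 1) ^ 2) / L := by
  have hΛ := (klth_klScale_pos (n + 1)).ne'
  have hΛj := (klth_klScale_pos j).ne'
  have hL : ((L : ℝ)) ≠ 0 := by exact_mod_cast NeZero.ne L
  have hπ : Real.pi ≠ 0 := Real.pi_pos.ne'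
  have h4 : klScale klE0 n = 4 * klScale klE0 (n + 1) := by rw [klth_klScale_succ]; ring
  unfold klmsRowBoundTCC
  rw [h4]
  field_simp
  ring

end Summit.HubbardSuperconductivity.HubbardSuperconductivity.Theorems.KLRegimeSplit

end
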